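import Summits.Ventures.HodgeRepro2.T5SU11ResolventNeumannSharpRadius
import Summits.Ventures.HodgeRepro2.T5SU11ResolventTransformEdge
import Summits.Ventures.HodgeRepro2.T5SU11ResolventNeumann
import Summits.Ventures.HodgeRepro2.T5SU11KernelDifferenceRegularity

/-!
# The ground-state transform of the composed kernels: `∫ K_λ^{∘(k+1)}(t, s) Ξ(t) sinh 2t dt = (−1/(λ − 1)²)^{k+1} Ξ(s)`,
and the exactness of the kernel's Taylor radius in the weak sense

The kernel source `K_λ(·, s)` is a class source at the rate `λ > 1` (row 522), so row 4xx's ground-state coefficient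
`∫ (G^I_λ g) Ξ sinh 2t = −(∫ g Ξ sinh 2t)/(μ + 1)` (`transform_greenSolI_one_eq`, sources of rate `> 1`) applies to it and to
all its iterates (row 503: the iterates stay in the class at every rate `< λ`):

* `transform_kernel` — **`∫ K_λ(t, s) Ξ(t) sinh 2t dt = −Ξ(s)/(μ + 1)`** (the kernel representation of `G^I_λ Ξ` and the
  eigen-relation of row 4xx);
* `transform_kernel_comp` — **`∫ K_λ^{∘(k+1)}(t, s) Ξ(t) sinh 2t dt = (−1/(μ + 1))^{k+1} Ξ(s)`** for every `k` and `s > 0`;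
* `summable_kernel_transform_iff`, `not_summable_kernel_transform` — **the Taylor coefficients of the kernel paired with the
  ground state, `Σ_k (μ − μ₂)^k ∫ K_{λ₂}^{∘(k+1)}(t, s) Ξ(t) sinh 2t dt`, form a series summable iff `|μ − μ₂| < (λ₂ − 1)²`**:
  the sharp disc of rows 577 / 591 / 601 is exact already in the weak (`Ξ`-transform) sense.

Nothing is claimed about (N).

Blind lane: Mathlib + the HodgeRepro2 prefix only; no sorry; axioms ⊆ {propext, Classical.choice,
Quot.sound}.
-/

namespace Summit.Ventures.HodgeRepro2.T5SU11KernelCompositionTransform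

open Filter Topology MeasureTheory
open Set (Ioi Ioc)
open T5SU11Cartan T5SU11SphericalFunction T5SU11SphericalBounds T5SU11SphericalDecay T5SU11RadialGreenKernel
  T5SU11RadialGreenImproper T5SU11RadialGreenImproperDecaySource T5SU11ResolventKernelComposition
  T5SU11ResolventEigenfunction T5SU11ResolventGroundStateWeight T5SU11ResolventTransformEdge T5SU11ResolventNeumann
  T5SU11KernelDifferenceRegularity T5SU11ResolventNeumannSharpRadius

section measure

variable [MeasurableSpace Circle] [BorelSpace Circle]

variable {lam : ℝ} (hlam : 1 < lam)

include hlam in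
/-- **The ground-state transform of the kernel**: `∫ K_λ(t, s) Ξ(t) sinh 2t dt = −Ξ(s)/(μ + 1)` for `s > 0`. -/
theorem transform_kernel {s : ℝ} (hs : 0 < s) :
    ∫ t in Ioi 0, sphGreenKernel lam t s * sph 1 (hyp t) * Real.sinh (2 * t)
      = -(sph 1 (hyp s) / (lam * (lam - 2) + 1)) := by
  obtain ⟨hΞ, ⟨Φ, hΦ0, hΦ⟩, hεΞ, CΞ, hCΞ⟩ := sph_one_class hlam
  have hB := integrableOn_sph_mul_mul_sinh_Ioc hΞ hΦ hΦ0 lam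
  have hA := integrableOn_sphDecay_mul_mul_sinh hlam hΞ hΦ hΦ0 hεΞ (fun t ht => hCΞ t ht)
  rw [← greenSolI_sph_one_eq hlam hs, greenSolI_eq_integral_kernel hB hA hs]
  apply setIntegral_congr_fun measurableSet_Ioi
  intro t _
  simp only [sphGreenKernel]
  rw [greenKernel_symm]

include hlam in
/-- **THE GROUND-STATE TRANSFORM OF THE COMPOSED KERNELS**: `∫ K_λ^{∘(k+1)}(t, s) Ξ(t) sinh 2t dt = (−1/(μ + 1))^{k+1} Ξ(s)` for
every `k` and `s > 0`. -/
theorem transform_kernel_comp {s : ℝ} (hs : 0 < s) (k : ℕ) :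
    ∫ t in Ioi 0, ((greenSolI (fun t => sph lam (hyp t)) (sphDecay lam))^[k] (fun r => sphGreenKernel lam r s)) t
        * sph 1 (hyp t) * Real.sinh (2 * t)
      = (-(1 / (lam * (lam - 2) + 1))) ^ (k + 1) * sph 1 (hyp s) := by
  induction k with
  | zero =>
    simp only [Function.iterate_zero, id_eq, zero_add, pow_one]
    rw [transform_kernel hlam hs]
    ring
  | succ k ih =>
    -- the class data of `(G^I_λ)^k K_λ(·, s)` at the rate `(1 + λ)/2 > 1` (row 503)
    obtain ⟨Ms, hMs0, hMs⟩ := kernel_source_bounded hlam hs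
    obtain ⟨Cs, s₀, hCs⟩ := kernel_source_decay hlam hs
    have hks := kernel_source_continuousOn hlam hs
    have hεk : 2 - lam < lam := by linarith
    obtain ⟨hck, ⟨Mk, hMk0, hMk⟩, hdk⟩ := iterate_class (lam₂ := lam) hlam hks hMs hMs0 hεk hCs k
    obtain ⟨Kk, Tk, _, _, hKk⟩ := hdk ((1 + lam) / 2) (by rw [min_self]; linarith)
    have hε1 : (1 : ℝ) < (1 + lam) / 2 := by linarith
    have htr := transform_greenSolI_one_eq hlam hck hMk hMk0 hKk hε1
    have e : ∀ t : ℝ, ((greenSolI (fun t => sph lam (hyp t)) (sphDecay lam))^[k + 1] (fun r => sphGreenKernel lam r s)) t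
        = greenSolI (fun t => sph lam (hyp t)) (sphDecay lam)
          ((greenSolI (fun t => sph lam (hyp t)) (sphDecay lam))^[k] (fun r => sphGreenKernel lam r s)) t :=
      fun t => by rw [Function.iterate_succ_apply']
    simp only [e]
    rw [htr, ih, pow_succ]
    ring

variable {lam₂ : ℝ} (hlam₂ : 1 < lam₂)

include hlam₂ in
/-- **The Taylor coefficients of the kernel paired with the ground state form a geometric series**: the series
`Σ_k (μ − μ₂)^k ∫ K_{λ₂}^{∘(k+1)}(t, s) Ξ(t) sinh 2t dt` is summable if and only if `|μ − μ₂| < (λ₂ − 1)²`. -/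
theorem summable_kernel_transform_iff {s : ℝ} (hs : 0 < s) :
    Summable (fun k : ℕ => (lam * (lam - 2) - lam₂ * (lam₂ - 2)) ^ k
        * ∫ t in Ioi 0, ((greenSolI (fun t => sph lam₂ (hyp t)) (sphDecay lam₂))^[k] (fun r => sphGreenKernel lam₂ r s)) t
          * sph 1 (hyp t) * Real.sinh (2 * t))
      ↔ |lam * (lam - 2) - lam₂ * (lam₂ - 2)| < (lam₂ - 1) ^ 2 := by
  have e : (fun k : ℕ => (lam * (lam - 2) - lam₂ * (lam₂ - 2)) ^ k
        * ∫ t in Ioi 0, ((greenSolI (fun t => sph lam₂ (hyp t)) (sphDecay lam₂))^[k] (fun r => sphGreenKernel lam₂ r s)) t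
          * sph 1 (hyp t) * Real.sinh (2 * t))
      = fun k : ℕ => (lam * (lam - 2) - lam₂ * (lam₂ - 2)) ^ k
        * ((greenSolI (fun t => sph lam₂ (hyp t)) (sphDecay lam₂))^[k + 1] (fun s => sph 1 (hyp s))) s := by
    funext k
    rw [transform_kernel_comp hlam₂ hs k, iterate_sph_one hlam₂ (k + 1) s hs]
  rw [e]
  exact summable_neumann_sph_one_iff hlam₂ hs

include hlam₂ in
/-- **Divergence outside the sharp disc**: for `|μ − μ₂| > (λ₂ − 1)²` the transformed Taylor series of the kernel diverges. -/
theorem not_summable_kernel_transform (hq : (lam₂ - 1) ^ 2 < |lam * (lam - 2) - lam₂ * (lam₂ - 2)|) {s : ℝ} (hs : 0 < s) :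
    ¬ Summable (fun k : ℕ => (lam * (lam - 2) - lam₂ * (lam₂ - 2)) ^ k
        * ∫ t in Ioi 0, ((greenSolI (fun t => sph lam₂ (hyp t)) (sphDecay lam₂))^[k] (fun r => sphGreenKernel lam₂ r s)) t
          * sph 1 (hyp t) * Real.sinh (2 * t)) := by
  rw [summable_kernel_transform_iff hlam₂ hs]
  exact not_lt.mpr hq.le

end measure

end Summit.Ventures.HodgeRepro2.T5SU11KernelCompositionTransform
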